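import Literature.AlgebraicGeometry.Frobenioids.ModelFrobenioidSelfEquivalenceRigidityCoboundary
import Literature.AlgebraicGeometry.Frobenioids.ModelFrobenioidSelfEquivalenceRigidity
import HarnessLib

/-!
# Frobenioids I, Thm. 5.2 (iv) / Prop. 5.6: rigidity of self-equivalences of a model Frobenioid over the
# identity of the base — AT PRINT STRENGTH (identity on the divisor monoid and on the RATIONAL FUNCTION
# monoid), via the Prop. 5.6 units

Mochizuki, *The geometry of Frobenioids I: the general theory*, Kyushu J. Math. **62** (2008) 293–400, §5,
Theorem 5.2 (i)/(iv) pp. 100–103, Proposition 5.6 p. 105 [cite: MochizukiFrdI2008, Thm. 5.2 p.100];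
consumer locus [IUTchI] proof of Corollary 5.3 (iv), kurims p. 144 l. 42 – p. 145 l. 9
[cite: Mochizuki2012, Cor. 5.3(iv) p.145]:

> "… it follows, by arguing as in the construction of the equivalence of categories given in the proof of
> [FrdI], Theorem 5.2, (iv), that the various units obtained in [FrdI], Proposition 5.6, determine […] an
> isomorphism between `α` and the identity self-equivalence of `ℱ̲_v`, as desired."

PROOF-ONLY (abc-iut, row «S2′ FRDI-SELFEQUIV-RIGIDITY AT PRINT STRENGTH», this file abc-iut-L1-t7; repairs the
reach of `ModelFrobenioidSelfEquivalenceRigidity.lean`, whose pointwise unit hypothesis `hunit` is the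
`u = 0` gauge-fixed special case — violated by unit-twist conjugates of the identity, hence too strong for the
genuine carriers).  THE THEOREM (`exists_iso_id_of_over_base_of_ratio`): on `C = ModelFrobenioid Φ B DivB` with
`B` objectwise group-like ([FrdI] Thm. 5.2), a functor `Ψ : C ⥤ C` lying over the identity of `D` (natural
base identification `e_X : Base(Ψ X) ⥲ Base X`), preserving Frobenius degrees, inducing the identity on the
DIVISOR monoid (`Div(Ψ φ) = e_X^* Div(φ)` — `Div` is category-theoretic, [FrdI] Thm. 3.4 (iii)) and the identity
on the RATIONAL FUNCTION monoid — `hratio`: for PARALLEL LINEAR `f, g : X → Y` over the same base arrow,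
`u_{Ψ f} · e_X^* u_g = u_{Ψ g} · e_X^* u_f`, i.e. `Ψ` preserves through `e` the birational unit `u_f − u_g ∈
O^×(A^birat) = B(A)` ([FrdI] Cor. 4.10, Thm. 5.2 (ii)) — is isomorphic to `𝟭_C`, by an isomorphism with
components `(1, e_X, 0, ω_X)`, `ω_X` the Prop. 5.6 / [IUTchI] Rmk. 5.3.3 units.  PROOF: the read-back
`κ(φ) := (e_X⁻¹)^* u_{Ψ φ}` is a twisted unit cocycle satisfying (K1) (composition law + naturality of `e` +
`hdeg`) and (K2) (= `hratio`), hence (`exists_coboundary`) the twisted coboundary of units `ω`; the class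
discrepancy corrected by `Div_B(ω)` then obeys the pure law `deg_Fr(φ) · c_X = Base(φ)^* c_Y` and vanishes
(`discrLaw_eq_one`, the engine of the gauge-fixed file stated for an abstract family); `(1, e_X, 0, e_X^* ω_X)`
is natural by the coboundary identity.  Corollaries: `η`-form and the printed shape for `Ψ : C ≌ C`.
No statement of either paper is restated as a fact; nothing here bears on [IUTchIII] Cor. 3.12.
-/

namespace Literature.AlgebraicGeometry.Frobenioids

open CategoryTheory Opposite

universe w v u

namespace ModelFrobenioid

/-- Three instances of relation (d)-bookkeeping in a commutative group: from `P^d · z = A · S`,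
`γ^d · z = G · T` and `S · W' = T · W^d`, `(P / (γ · W))^d = A / (G · W')`. [folklore] -/
private theorem law_of_three_rels {G₀ : Type*} [CommGroup G₀] {P z A S γ G T W W' : G₀} {d : ℕ}
    (h₁ : P ^ d * z = A * S) (h₂ : γ ^ d * z = G * T) (h₃ : S * W' = T * W ^ d) :
    (P / (γ * W)) ^ d = A / (G * W') := by
  rw [div_pow, mul_pow, eq_mul_inv_of_mul_eq h₁, eq_mul_inv_of_mul_eq h₂, div_eq_div_iff_mul_eq_mul]
  calc A * S * z⁻¹ * (G * W') = A * G * z⁻¹ * (S * W') := by ac_rfl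
    _ = A * G * z⁻¹ * (T * W ^ d) := by rw [h₃]
    _ = A * (G * T * z⁻¹ * W ^ d) := by ac_rfl

variable {D : Type u} [Category.{v} D] {Φ B : Dᵒᵖ ⥤ CommMonCat.{w}} {DivB : B ⟶ monoidGp Φ}

section Engine

/-- **The discrepancy engine, abstract form**: a family `c_X ∈ Φ(Base X)^gp` with
`deg_Fr(φ) · c_X = Base(φ)^* c_Y` along EVERY morphism is trivial — constant on fibres along the pre-steps
`(1, id, z, 0)` (every class is a difference of elements of `Φ`), doubled by the degree-`2` Frobenius morphism
`(2, id, 0, 1)`. (The engine of `ModelFrobenioidSelfEquivalenceRigidity.lean`, stated for an abstract family.)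
[cite: MochizukiFrdI2008, Thm. 5.2(iv) p.102] -/
theorem discrLaw_eq_one (c : ∀ X : ModelFrobenioid Φ B DivB, Algebra.GrothendieckGroup (Φ.obj (op X.base)))
    (hc : ∀ ⦃X Y : ModelFrobenioid Φ B DivB⦄ (φ : X ⟶ Y), c X ^ (degFr φ : ℕ) = pullGp Φ (baseMap φ) (c Y))
    (X : ModelFrobenioid Φ B DivB) : c X = 1 := by
  -- along pre-steps
  have hstep : ∀ (A : D) (α : Algebra.GrothendieckGroup (Φ.obj (op A))) (z : Φ.obj (op A)),
      c ⟨A, α⟩ = c ⟨A, α * Algebra.GrothendieckGroup.of z⟩ := by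
    intro A α z
    let s : (⟨A, α⟩ : ModelFrobenioid Φ B DivB) ⟶ ⟨A, α * Algebra.GrothendieckGroup.of z⟩ :=
      mkHom _ _ 1 (𝟙 A) z 1
        (rel_step (B := B) (DivB := DivB) (γ := α) (δ := α * Algebra.GrothendieckGroup.of z) (w := z) rfl)
    have h := hc s
    rw [show degFr s = 1 from rfl, PNat.one_coe, pow_one, show baseMap s = 𝟙 A from rfl, pullGp_id] at h
    exact h
  -- constant on fibres
  have hfib : ∀ (A : D) (α β : Algebra.GrothendieckGroup (Φ.obj (op A))), c ⟨A, α⟩ = c ⟨A, β⟩ := by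
    intro A α β
    obtain ⟨x, y, hq⟩ := exists_cls_eq_div (⟨A, β / α⟩ : ModelFrobenioid Φ B DivB)
    dsimp only at x y hq
    have hαβ : α * Algebra.GrothendieckGroup.of x = β * Algebra.GrothendieckGroup.of y := by
      rw [div_eq_div_iff_mul_eq_mul] at hq
      rw [mul_comm α, ← hq, mul_comm]
    rw [hstep A α x, hstep A β y, hαβ]
  -- doubled along the Frobenius morphism `(2, id, 0, 1)`
  obtain ⟨A, α⟩ := X
  let f : (⟨A, α⟩ : ModelFrobenioid Φ B DivB) ⟶ ⟨A, α ^ 2⟩ :=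
    mkHom _ _ 2 (𝟙 A) 1 1 (rel_frob (B := B) (DivB := DivB) α 2)
  have h := hc f
  rw [show degFr f = 2 from rfl, show (((2 : ℕ+) : ℕ)) = 2 from rfl, show baseMap f = 𝟙 A from rfl,
    pullGp_id, ← hfib A α (α ^ 2), pow_two] at h
  have h' : c ⟨A, α⟩ * c ⟨A, α⟩ = c ⟨A, α⟩ * 1 := by rw [mul_one]; exact h
  exact mul_left_cancel h'

end Engine

section Units

variable {Ψ : ModelFrobenioid Φ B DivB ⥤ ModelFrobenioid Φ B DivB}
  (e : ∀ X : ModelFrobenioid Φ B DivB, (Ψ.obj X).base ≅ X.base)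
  (hen : ∀ ⦃X Y : ModelFrobenioid Φ B DivB⦄ (φ : X ⟶ Y),
    baseMap (Ψ.map φ) ≫ (e Y).hom = (e X).hom ≫ baseMap φ)
  (hdeg : ∀ ⦃X Y : ModelFrobenioid Φ B DivB⦄ (φ : X ⟶ Y), degFr (Ψ.map φ) = degFr φ)
  (hdiv : ∀ ⦃X Y : ModelFrobenioid Φ B DivB⦄ (φ : X ⟶ Y),
    div (Ψ.map φ) = pull Φ (e X).hom (div φ))
  (hB : ∀ (A : Dᵒᵖ) (b : B.obj A), IsUnit b)
  (hratio : ∀ ⦃X Y : ModelFrobenioid Φ B DivB⦄ (f g : X ⟶ Y), degFr f = 1 → degFr g = 1 →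
    baseMap f = baseMap g →
      unit (Ψ.map f) * pull B (e X).hom (unit g) = unit (Ψ.map g) * pull B (e X).hom (unit f))

include hen hdeg in
/-- **(K1) for the read-back units** `κ(φ) := (e_X⁻¹)^* u_{Ψ φ}`: `κ(ψ ∘ φ) = Base(φ)^* κ(ψ) · κ(φ)^{deg_Fr ψ}` — the
composition law of `u` for `Ψ φ, Ψ ψ`, transported along `e`, with `hdeg`. [cite: MochizukiFrdI2008, Thm. 5.2(i) p.100] -/
theorem unitReadBack_comp {X Y Z : ModelFrobenioid Φ B DivB} (φ : X ⟶ Y) (ψ : Y ⟶ Z) :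
    pull B (e X).inv (unit (Ψ.map (φ ≫ ψ))) =
      pull B (baseMap φ) (pull B (e Y).inv (unit (Ψ.map ψ))) * pull B (e X).inv (unit (Ψ.map φ)) ^ (degFr ψ : ℕ) := by
  rw [Functor.map_comp, unit_comp_pull, map_mul, map_pow, ← pull_comp, ← baseIso_inv_naturality e hen φ,
    pull_comp, hdeg]

include hratio in
/-- **(K2) for the read-back units** = `hratio` transported along `e`: `κ(f) · u_g = κ(g) · u_f` for parallel
linear `f, g` over the same base arrow. [cite: MochizukiFrdI2008, Thm. 5.2(ii) p.101] -/
theorem unitReadBack_ratio {X Y : ModelFrobenioid Φ B DivB} (f g : X ⟶ Y) (hf : degFr f = 1) (hg : degFr g = 1)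
    (hb : baseMap f = baseMap g) :
    pull B (e X).inv (unit (Ψ.map f)) * unit g = pull B (e X).inv (unit (Ψ.map g)) * unit f := by
  have h := congrArg (pull B (e X).inv) (hratio f g hf hg hb)
  rw [map_mul, map_mul, ← pull_comp, ← pull_comp, Iso.inv_hom_id, pull_id, pull_id] at h
  exact h

include hen hdeg hdiv in
/-- **Relation (d) for `Ψ φ`, pulled back along `e_X⁻¹`** (no unit hypothesis): `deg_Fr(φ) · (e_X⁻¹)^* cls(Ψ X)
+ Div(φ) = Base(φ)^* (e_Y⁻¹)^* cls(Ψ Y) + Div_B(κ(φ))`. [cite: MochizukiFrdI2008, Thm. 5.2(i) p.100] -/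
theorem rel_map_pullGp_baseIso_readBack {X Y : ModelFrobenioid Φ B DivB} (φ : X ⟶ Y) :
    pullGp Φ (e X).inv (Ψ.obj X).cls ^ (degFr φ : ℕ) * Algebra.GrothendieckGroup.of (div φ) =
      pullGp Φ (baseMap φ) (pullGp Φ (e Y).inv (Ψ.obj Y).cls) *
        divB Φ B DivB (op X.base) (pull B (e X).inv (unit (Ψ.map φ))) := by
  have h := congrArg (pullGp Φ (e X).inv) (rel (Ψ.map φ))
  rw [map_mul, map_pow, map_mul, pullGp_of, pullGp_divB, ← pullGp_comp,
    ← baseIso_inv_naturality e hen φ, pullGp_comp, hdeg, hdiv] at h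
  have h₁ : (Φ.map (e X).inv.op).hom (pull Φ (e X).hom (div φ)) = div φ := by
    show pull Φ (e X).inv (pull Φ (e X).hom (div φ)) = div φ
    rw [← pull_comp, Iso.inv_hom_id, pull_id]
  rw [h₁] at h
  exact h

include hen hdeg hdiv hB hratio in
/-- **Rigidity at print strength ([FrdI] Thm. 5.2 (iv) / Prop. 5.6; [IUTchI] Cor. 5.3 (iv) injectivity
criterion).**  A functor `Ψ : C ⥤ C` of the model Frobenioid of `(Φ, B, Div_B)` (`B` objectwise group-like)
lying over the identity of `D` through a natural family `e_X : Base(Ψ X) ⥲ Base X`, preserving Frobenius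
degrees, inducing through `e` the identity on the divisor monoid (`Div(Ψ φ) = e_X^* Div(φ)`) and on the
rational function monoid (`hratio`: the birational unit of two parallel linear arrows over the same base arrow
is preserved), is isomorphic to `𝟭_C` by an isomorphism with components `(1, e_X, 0, ω_X)` — `ω_X` the units of
Prop. 5.6. [cite: MochizukiFrdI2008, Thm. 5.2(iv) p.102] [cite: Mochizuki2012, Cor. 5.3(iv) p.145] -/
theorem exists_iso_id_of_over_base_of_ratio :
    ∃ ι : Ψ ≅ 𝟭 (ModelFrobenioid Φ B DivB), ∀ X : ModelFrobenioid Φ B DivB,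
      degFr (ι.hom.app X) = 1 ∧ baseMap (ι.hom.app X) = (e X).hom ∧ div (ι.hom.app X) = 1 := by
  -- the read-back units form a twisted cocycle; take its coboundary units `ω`
  obtain ⟨ω, hω⟩ := exists_coboundary hB (fun X Y φ => pull B (e X).inv (unit (Ψ.map φ)))
    (fun X Y Z φ ψ => unitReadBack_comp e hen hdeg φ ψ)
    (fun X Y f g hf hg hb => unitReadBack_ratio e hratio f g hf hg hb)
  -- the corrected class discrepancy obeys the pure law, hence vanishes
  have hcls : ∀ X : ModelFrobenioid Φ B DivB,
      pullGp Φ (e X).inv (Ψ.obj X).cls = X.cls * divB Φ B DivB (op X.base) (ω X) := by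
    have hlaw := discrLaw_eq_one
      (fun X => pullGp Φ (e X).inv (Ψ.obj X).cls / (X.cls * divB Φ B DivB (op X.base) (ω X))) (by
        intro X Y φ
        have h₃ := congrArg (divB Φ B DivB (op X.base)) (hω φ)
        rw [map_mul, map_mul, map_pow] at h₃
        rw [map_div, map_mul, pullGp_divB]
        exact law_of_three_rels (rel_map_pullGp_baseIso_readBack e hen hdeg hdiv φ) (rel φ) h₃)
    intro X
    exact div_eq_one.mp (hlaw X)
  have hcls' : ∀ X : ModelFrobenioid Φ B DivB,
      (Ψ.obj X).cls = pullGp Φ (e X).hom X.cls * divB Φ B DivB (op (Ψ.obj X).base) (pull B (e X).hom (ω X)) := by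
    intro X
    calc (Ψ.obj X).cls = pullGp Φ ((e X).hom ≫ (e X).inv) (Ψ.obj X).cls := by rw [Iso.hom_inv_id, pullGp_id]
      _ = pullGp Φ (e X).hom (X.cls * divB Φ B DivB (op X.base) (ω X)) := by rw [pullGp_comp, hcls]
      _ = pullGp Φ (e X).hom X.cls * divB Φ B DivB (op (Ψ.obj X).base) (pull B (e X).hom (ω X)) := by
            rw [map_mul, pullGp_divB]
            rfl
  -- the inverse units
  have hωu : ∀ X : ModelFrobenioid Φ B DivB, ∃ ω' : B.obj (op X.base), ω X * ω' = 1 := fun X => by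
    obtain ⟨ι, hι⟩ := hB _ (ω X)
    exact ⟨↑ι⁻¹, by rw [← hι, Units.mul_inv]⟩
  choose ω' hω' using hωu
  -- the components `(1, e_X, 0, e_X^* ω_X) : Ψ X → X` and their inverses `(1, e_X⁻¹, 0, ω'_X)`
  let θ : ∀ X : ModelFrobenioid Φ B DivB, Ψ.obj X ⟶ X := fun X =>
    mkHom _ _ 1 (e X).hom 1 (pull B (e X).hom (ω X)) (by
      rw [PNat.one_coe, pow_one, map_one, mul_one]
      exact hcls' X)
  let θ' : ∀ X : ModelFrobenioid Φ B DivB, X ⟶ Ψ.obj X := fun X =>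
    mkHom _ _ 1 (e X).inv 1 (ω' X) (by
      rw [PNat.one_coe, pow_one, map_one, mul_one, hcls, mul_assoc, ← map_mul, hω', map_one, mul_one])
  have hθθ' : ∀ X, θ X ≫ θ' X = 𝟙 (Ψ.obj X) := fun X => by
    refine hom_ext (mul_one 1) (e X).hom_inv_id ?_ ?_
    · show pull Φ (e X).hom 1 * 1 ^ ((1 : ℕ+) : ℕ) = 1
      rw [map_one, one_pow, mul_one]
    · show pull B (e X).hom (ω' X) * pull B (e X).hom (ω X) ^ ((1 : ℕ+) : ℕ) = 1
      rw [PNat.one_coe, pow_one, ← map_mul, mul_comm, hω', map_one]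
  have hθ'θ : ∀ X, θ' X ≫ θ X = 𝟙 X := fun X => by
    refine hom_ext (mul_one 1) (e X).inv_hom_id ?_ ?_
    · show pull Φ (e X).inv 1 * 1 ^ ((1 : ℕ+) : ℕ) = 1
      rw [map_one, one_pow, mul_one]
    · show pull B (e X).inv (pull B (e X).hom (ω X)) * ω' X ^ ((1 : ℕ+) : ℕ) = 1
      rw [← pull_comp, Iso.inv_hom_id, pull_id, PNat.one_coe, pow_one, hω']
  -- naturality: the unit entry is the coboundary identity read through `e_X`
  have hnat : ∀ {X Y : ModelFrobenioid Φ B DivB} (φ : X ⟶ Y), Ψ.map φ ≫ θ Y = θ X ≫ φ := by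
    intro X Y φ
    refine hom_ext ?_ (hen φ) ?_ ?_
    · show (1 : ℕ+) * degFr (Ψ.map φ) = degFr φ * 1
      rw [hdeg, one_mul, mul_one]
    · show pull Φ (baseMap (Ψ.map φ)) 1 * div (Ψ.map φ) ^ ((1 : ℕ+) : ℕ) =
        pull Φ (e X).hom (div φ) * 1 ^ (degFr φ : ℕ)
      rw [map_one, one_mul, PNat.one_coe, pow_one, one_pow, mul_one, hdiv]
    · show pull B (baseMap (Ψ.map φ)) (pull B (e Y).hom (ω Y)) * unit (Ψ.map φ) ^ ((1 : ℕ+) : ℕ) =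
        pull B (e X).hom (unit φ) * pull B (e X).hom (ω X) ^ (degFr φ : ℕ)
      have h := congrArg (pull B (e X).hom) (hω φ)
      rw [map_mul, map_mul, map_pow, ← pull_comp, ← pull_comp, Iso.hom_inv_id, pull_id, ← hen φ,
        pull_comp] at h
      rw [PNat.one_coe, pow_one, mul_comm]
      exact h
  refine ⟨NatIso.ofComponents (fun X => ⟨θ X, θ' X, hθθ' X, hθ'θ X⟩) (fun φ => hnat φ), fun X => ?_⟩
  exact ⟨rfl, rfl, rfl⟩

include hen hdeg hdiv hB hratio in
/-- The same, as a bare existence statement: `Ψ ≅ 𝟭_C`. [cite: MochizukiFrdI2008, Thm. 5.2(iv) p.102] -/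
theorem nonempty_iso_id_of_over_base_of_ratio : Nonempty (Ψ ≅ 𝟭 (ModelFrobenioid Φ B DivB)) := by
  obtain ⟨ι, -⟩ := exists_iso_id_of_over_base_of_ratio e hen hdeg hdiv hB hratio
  exact ⟨ι⟩

end Units

section OverBaseIso

variable {Ψ : ModelFrobenioid Φ B DivB ⥤ ModelFrobenioid Φ B DivB}

/-- **Rigidity at print strength, natural-isomorphism form**: `Ψ : C ⥤ C` with `η : Ψ ⋙ Base ≅ Base`,
preserving Frobenius degrees, identity on the divisor monoid and on the rational function monoid (`hratio`)
through `η`, `B` objectwise group-like, is `≅ 𝟭_C` by an isomorphism over `η` with trivial divisors.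
[cite: MochizukiFrdI2008, Thm. 5.2(iv) p.102] [cite: Mochizuki2012, Cor. 5.3(iv) p.145] -/
theorem exists_iso_id_of_over_baseIso_of_ratio (η : Ψ ⋙ baseFunctor Φ B DivB ≅ baseFunctor Φ B DivB)
    (hdeg : ∀ ⦃X Y : ModelFrobenioid Φ B DivB⦄ (φ : X ⟶ Y), degFr (Ψ.map φ) = degFr φ)
    (hdiv : ∀ ⦃X Y : ModelFrobenioid Φ B DivB⦄ (φ : X ⟶ Y),
      div (Ψ.map φ) = pull Φ (η.hom.app X : (Ψ.obj X).base ⟶ X.base) (div φ))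
    (hB : ∀ (A : Dᵒᵖ) (b : B.obj A), IsUnit b)
    (hratio : ∀ ⦃X Y : ModelFrobenioid Φ B DivB⦄ (f g : X ⟶ Y), degFr f = 1 → degFr g = 1 →
      baseMap f = baseMap g →
        unit (Ψ.map f) * pull B (A := X.base) (B := (Ψ.obj X).base) (η.hom.app X) (unit g) =
          unit (Ψ.map g) * pull B (A := X.base) (B := (Ψ.obj X).base) (η.hom.app X) (unit f)) :
    ∃ ι : Ψ ≅ 𝟭 (ModelFrobenioid Φ B DivB), ∀ X : ModelFrobenioid Φ B DivB,
      degFr (ι.hom.app X) = 1 ∧ baseMap (ι.hom.app X) = (η.hom.app X : (Ψ.obj X).base ⟶ X.base) ∧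
        div (ι.hom.app X) = 1 :=
  exists_iso_id_of_over_base_of_ratio (fun X => η.app X) (fun _ _ φ => η.hom.naturality φ) hdeg hdiv hB hratio

/-- The same, as a bare existence statement. [cite: MochizukiFrdI2008, Thm. 5.2(iv) p.102] -/
theorem nonempty_iso_id_of_over_baseIso_of_ratio (η : Ψ ⋙ baseFunctor Φ B DivB ≅ baseFunctor Φ B DivB)
    (hdeg : ∀ ⦃X Y : ModelFrobenioid Φ B DivB⦄ (φ : X ⟶ Y), degFr (Ψ.map φ) = degFr φ)
    (hdiv : ∀ ⦃X Y : ModelFrobenioid Φ B DivB⦄ (φ : X ⟶ Y),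
      div (Ψ.map φ) = pull Φ (η.hom.app X : (Ψ.obj X).base ⟶ X.base) (div φ))
    (hB : ∀ (A : Dᵒᵖ) (b : B.obj A), IsUnit b)
    (hratio : ∀ ⦃X Y : ModelFrobenioid Φ B DivB⦄ (f g : X ⟶ Y), degFr f = 1 → degFr g = 1 →
      baseMap f = baseMap g →
        unit (Ψ.map f) * pull B (A := X.base) (B := (Ψ.obj X).base) (η.hom.app X) (unit g) =
          unit (Ψ.map g) * pull B (A := X.base) (B := (Ψ.obj X).base) (η.hom.app X) (unit f)) :
    Nonempty (Ψ ≅ 𝟭 (ModelFrobenioid Φ B DivB)) := by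
  obtain ⟨ι, -⟩ := exists_iso_id_of_over_baseIso_of_ratio η hdeg hdiv hB hratio
  exact ⟨ι⟩

/-- **«FRDI-SELFEQUIV-RIGIDITY» at print strength — the printed shape** ([IUTchI] p. 145 l. 1–9 at the model
Frobenioid of [FrdI] Thm. 5.2, `B` group-like): a self-equivalence `Ψ : C ≌ C` lying over the identity of `D`
(`η : Ψ ⋙ Base ≅ Base`) that preserves Frobenius degrees and induces through `η` the identity on the divisor
monoid and on the rational function monoid (`hratio`) is isomorphic to the identity self-equivalence.
[cite: MochizukiFrdI2008, Thm. 5.2(iv) p.102] [cite: Mochizuki2012, Cor. 5.3(iv) p.145] -/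
theorem selfEquivalence_iso_id_of_over_base_of_ratio
    (Ψ : ModelFrobenioid Φ B DivB ≌ ModelFrobenioid Φ B DivB)
    (η : Ψ.functor ⋙ baseFunctor Φ B DivB ≅ baseFunctor Φ B DivB)
    (hdeg : ∀ ⦃X Y : ModelFrobenioid Φ B DivB⦄ (φ : X ⟶ Y), degFr (Ψ.functor.map φ) = degFr φ)
    (hdiv : ∀ ⦃X Y : ModelFrobenioid Φ B DivB⦄ (φ : X ⟶ Y),
      div (Ψ.functor.map φ) = pull Φ (η.hom.app X : (Ψ.functor.obj X).base ⟶ X.base) (div φ))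
    (hB : ∀ (A : Dᵒᵖ) (b : B.obj A), IsUnit b)
    (hratio : ∀ ⦃X Y : ModelFrobenioid Φ B DivB⦄ (f g : X ⟶ Y), degFr f = 1 → degFr g = 1 →
      baseMap f = baseMap g →
        unit (Ψ.functor.map f) * pull B (A := X.base) (B := (Ψ.functor.obj X).base) (η.hom.app X) (unit g) =
          unit (Ψ.functor.map g) * pull B (A := X.base) (B := (Ψ.functor.obj X).base) (η.hom.app X) (unit f)) :
    Nonempty (Ψ.functor ≅ 𝟭 (ModelFrobenioid Φ B DivB)) :=
  nonempty_iso_id_of_over_baseIso_of_ratio η hdeg hdiv hB hratio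

end OverBaseIso

end ModelFrobenioid

end Literature.AlgebraicGeometry.Frobenioids
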